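/-
Origin: expansion seat `prover-pub-hodgecm-own-htheta-g2-0`, handover #H32 2026-08-21T14:05:49Z md5 80514b43a8c3 (153 l.; NEW additive MODEL leaf — SCHAIN row 3 of 11: face-scope `_S`∕`_gal` twin of `HodgeCM/Model/E2InstanceOGR8.lean`-class head (scope triple ↦ `S c` ∕ `6 ≤ finrank ℚ c.K ∧ IsNormalClosure ℚ c.K L`); author item6-p2 (prover-pub-hodgecm2-item6-p2-0) under own-htheta; nothing cited beyond the record's binders; NOT an E term; sha256 30bb23bff4e0b887c4a4f778c04f247a1dc509b833b20f3e30067a80051957b7; CERT rc 0 + trio as in the header; NAMES for audit: HodgeCM.Model.thetaSub_of_factOG_S HodgeCM.Model.thetaRealisation₂_picardCM_r8coreOG_S ) (`HOME/pub-hodgecm-own-htheta/stage81/HodgeCM/Model/E2InstanceOGR8S.lean`, md5 80514b43a8c3, 153 lines);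
landed by the p-seat packager p gen 32 (p-g32) in gate run 80 as `HodgeCM/Model/E2InstanceOGR8S.lean` (verbatim).
-/
/-
Copyright (c) 2026 the pub-hodgecm formalisation cell (harness21).  New file, not vendored.
Origin: seat `prover-pub-hodgecm2-item6-p2-0` (unit pub-hodgecm2-item6-p2, TRANSPOSITION item (vi) extra prover p2 queued behind the own-htheta
lineage; coordinator ruling 2026-08-21T13:01:49Z), 2026-08-21 — CLAIM pub-hodgecm STATUS 13:45:32Z «SCOPE-PARAMETRIC POINTWISE E-CHAIN `…_S`»
(hodge-director/ITEM6-SPLIT.md (vi-4); x2 `E-HEADS-FACE-BLUEPRINT.md` v1.1 fc085fc795dd §3 step (3)).  Target in PKG: `HodgeCM/Model/E2InstanceOGR8S.lean`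
(NEW additive leaf beside `HodgeCM/Model/E2InstanceOGR8.lean`, installed md5 98223c1dd777; imports `HodgeCM.Model.E2InstanceOGR8` + `HodgeCM.Model.E2InstanceOGS` + `HodgeCM.Model.ThetaSpaceInputPinGe`; nothing of record imports it).
KERNEL ONLY: theorems, no proof holes, nothing cited, no `def`, no hypothesis kind of E; nothing here is a claim of the manuscripts under adjudication;
HC_CM is NOT proved.

WHAT IT IS — layer A8/A7 (CORE over the CM-inflation parameter) of the scope-parametric chain: the `_S` form of `thetaSub_of_factOG` and `perLCanonical_picardCM_r8coreOG`.  Statement = the original's VERBATIM except: (1) two new leading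
binders `scope : ∀ {L}, SeesawCtx L → Prop` and `hscope : ∀ c, scope c → 6 ≤ finrank ℚ c.K`; (2) E's literal scope triple
`Module.finrank ℚ c.K = 6 ∧ IsNormalClosure ℚ c.K L ∧ (… = 24 ∨ … = 48)` in every slot type ↦ `scope c`; (3) the regime proof terms
`two_lt_finrank_of_goodCtx … hc hK.1` / `isAnisotropic_of_goodCtx … hK.1` / `translOf … hK.1` ↦ x1's `_ge` forms (#H21 `Model/ThetaSpaceInputPinGe.lean`) at
`(hscope c hK)`; (4) the CONCLUSION `U.PerLCanonical` ↦ the POINTWISE one `∀ V c, GoodCtx ι₁ c → scope c → (mk ι₁).embedding = ι₁ →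
Nonempty (U.ThetaRealisation₂ ι₁ V c.K c.Ψ c.σ)`; (5) the head call ↦ the `_S` predecessor.  Proof otherwise the original's.  E's layer is NOT re-derived
from this one (E stays as installed); the two are siblings.  Generated from the installed bytes by `work/gen_schain.py` (edit list `work/gen_schain.report`).
-/
import Summits.HodgeConjecture.HodgeCM.Model.E2InstanceOGR8
import Summits.HodgeConjecture.HodgeCM.Model.E2InstanceOGS
import Summits.HodgeConjecture.HodgeCM.Model.ThetaSpaceInputPinGe

/-! PORT of `HodgeCM/Model/E2InstanceOGR8S.lean` (HodgeCMPerL run 82) — verbatim mechanical port; provenance in the PORT header line. -/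

set_option autoImplicit false

noncomputable section

open scoped TensorProduct InnerProductSpace Matrix

namespace HodgeCM

namespace Model

open HodgeCM.Universe (AdelicThetaCore AdelicThetaCore₀ SideData ThetaModel ModelAxiomsPerL)
open Literature.AlgebraicGeometry.HodgeTheory
open Literature.AlgebraicGeometry.ComplexMultiplication (Shimura1998_Thm3_isogenousPower Shimura1998_Thm2_Cor)
open Literature.NumberTheory.Automorphic.PicardCM
open Literature.NumberTheory.Transcendental (Arapura2012_Cor_15_4_6)
open HodgeCM.CMTypeOps (inflate)
open HodgeCM.Model.SupplyInstance (LineSupplyData)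
open HodgeCM.Model.SupplyResidual (ClassSupplyPackN)

variable (hHD : exists_isReal_hodgeModel) (hI : hodgePQ_independent_of_hodgeModel)
  (h₁ : BallQuotientUniformised)  (h₃ : CMAbelianVarietyRealised)

/-- `_S` (SCOPE-PARAMETRIC, POINTWISE-CONCLUSION) form of `thetaSub_of_factOG`: E's scope triple ↦ a free class `scope c`, regime at `hscope`, conclusion = `ThetaRealisation₂` at every good context of the class. ORIENTED-FAMILY twin of `thetaSub_of_fact` (statement `h ↦ hb L ι₁`, proof verbatim). -/
theorem thetaSub_of_factOG_S (scope : ∀ {L : CMField}, SeesawCtx L → Prop)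
    (hb : ∀ L : CMField, (L →+* ℂ) → Bool) (hA : Arapura2012_Cor_15_4_6)
    (W : ∀ {L : CMField} {ι₁ : L →+* ℂ} (V : HermSpace3 L ι₁) (c : SeesawCtx L), WmInput V c.D)
    (X : ∀ {L : CMField} {ι₁ : L →+* ℂ} (V : HermSpace3 L ι₁) (c : SeesawCtx L),
      ThetaSpaceInput (picardCMUniverse hHD hI h₁ h₃) V c)
    (μ : ∀ {L : CMField}, SeesawCtx L → Fin 4 → NumberField.InfinitePlace L → ℤ)
    (h31 : (picardCMUniverse hHD hI h₁ h₃).Fact_cmInflation)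
    (hLiu : ∀ {L : CMField} {ι₁ : L →+* ℂ} (V : HermSpace3 L ι₁) (c : SeesawCtx L),
      (thetaModelOf hHD hI h₁ h₃ (hb L ι₁) (embOf hHD hI h₁ h₃) (coverOf hHD hI h₁ h₃ hA) (wmOfInput W) (thetaOf _ (thetaClassInputOf _ X)) (d12Of μ) (d34Of μ)).GoodCtx ι₁ c → scope c →
      (NumberField.InfinitePlace.mk ι₁).embedding = ι₁ →
      ∀ (i : Fin 4) (Γ : Level V), ∃ (M : CMField) (k : c.K →+* M) (σ' : M →+* ℂ), σ'.comp k = c.σ ∧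
        (thetaModelOf hHD hI h₁ h₃ (hb L ι₁) (embOf hHD hI h₁ h₃) (coverOf hHD hI h₁ h₃ hA) (wmOfInput W) (thetaOf _ (thetaClassInputOf _ X)) (d12Of μ) (d34Of μ)).Theta V c i Γ ⊆
          (picardCMUniverse hHD hI h₁ h₃).Uiso Γ M (inflate k (c.Ψ i)) σ')
    {L : CMField} {ι₁ : L →+* ℂ} (V : HermSpace3 L ι₁) (c : SeesawCtx L)
    (hc : (thetaModelOf hHD hI h₁ h₃ (hb L ι₁) (embOf hHD hI h₁ h₃) (coverOf hHD hI h₁ h₃ hA) (wmOfInput W) (thetaOf _ (thetaClassInputOf _ X)) (d12Of μ) (d34Of μ)).GoodCtx ι₁ c) (hK : scope c) (hcan : (NumberField.InfinitePlace.mk ι₁).embedding = ι₁) (i : Fin 4) (Γ : Level V) :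
    (thetaModelOf hHD hI h₁ h₃ (hb L ι₁) (embOf hHD hI h₁ h₃) (coverOf hHD hI h₁ h₃ hA) (wmOfInput W) (thetaOf _ (thetaClassInputOf _ X)) (d12Of μ) (d34Of μ)).Theta V c i Γ ⊆
      (picardCMUniverse hHD hI h₁ h₃).Uiso Γ c.K (c.Ψ i) c.σ := by
  intro ω hω
  obtain ⟨M, k, σ', hσ, hsub⟩ := hLiu V c hc hK hcan i Γ
  have hle := Universe.Uiso_inflate_le (Model.modelAxiomsPerL hHD hI h₃ h₁).pull_comp
    (Model.fact_alphaLine (hHD := hHD) (hI := hI) (h₁ := h₁) (h₃ := h₃))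
    h31 Γ c.K M k (c.Ψ i) σ' (hsub hω)
  rw [hσ] at hle
  exact hle

/-- `_S` (SCOPE-PARAMETRIC, POINTWISE-CONCLUSION) form of `perLCanonical_picardCM_r8coreOG`: E's scope triple ↦ a free class `scope c`, regime at `hscope`, conclusion = `ThetaRealisation₂` at every good context of the class. **ORIENTED-FAMILY twin of `perL_picardCM_r8core`** (`E2InstanceR8`): the recipe bit per complex place, `h ↦ hb L ι₁` in every binder;
proof = the source proof over the oriented predecessor. -/
theorem thetaRealisation₂_picardCM_r8coreOG_S (scope : ∀ {L : CMField}, SeesawCtx L → Prop) (hscope : ∀ {L : CMField} (c : SeesawCtx L), scope c → 6 ≤ Module.finrank ℚ c.K)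
    (hHR : BettiUniverse.HodgeRiemann20) (hb : ∀ L : CMField, (L →+* ℂ) → Bool)
    (hA : Arapura2012_Cor_15_4_6)
    (W : ∀ {L : CMField} {ι₁ : L →+* ℂ} (V : HermSpace3 L ι₁) (c : SeesawCtx L), WmInput V c.D)
    (X : ∀ {L : CMField} {ι₁ : L →+* ℂ} (V : HermSpace3 L ι₁) (c : SeesawCtx L),
      ThetaSpaceInput (picardCMUniverse hHD hI h₁ h₃) V c)
    (μ : ∀ {L : CMField}, SeesawCtx L → Fin 4 → NumberField.InfinitePlace L → ℤ)
    (hBetti : ∀ {L : CMField} {ι₁ : L →+* ℂ} (V : HermSpace3 L ι₁), EmbBettiSide hHD hI h₁ h₃ V)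
    (h31 : (picardCMUniverse hHD hI h₁ h₃).Fact_cmInflation)
    (hLiu : ∀ {L : CMField} {ι₁ : L →+* ℂ} (V : HermSpace3 L ι₁) (c : SeesawCtx L),
      (thetaModelOf hHD hI h₁ h₃ (hb L ι₁) (embOf hHD hI h₁ h₃) (coverOf hHD hI h₁ h₃ hA) (wmOfInput W) (thetaOf _ (thetaClassInputOf _ X)) (d12Of μ) (d34Of μ)).GoodCtx ι₁ c → scope c →
      (NumberField.InfinitePlace.mk ι₁).embedding = ι₁ →
      ∀ (i : Fin 4) (Γ : Level V), ∃ (M : CMField) (k : c.K →+* M) (σ' : M →+* ℂ), σ'.comp k = c.σ ∧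
        (thetaModelOf hHD hI h₁ h₃ (hb L ι₁) (embOf hHD hI h₁ h₃) (coverOf hHD hI h₁ h₃ hA) (wmOfInput W) (thetaOf _ (thetaClassInputOf _ X)) (d12Of μ) (d34Of μ)).Theta V c i Γ ⊆
          (picardCMUniverse hHD hI h₁ h₃).Uiso Γ M (inflate k (c.Ψ i)) σ')
    (thetaSat : ∀ {L : CMField} {ι₁ : L →+* ℂ} (V : HermSpace3 L ι₁) (c : SeesawCtx L)
      (i : Fin 4) (Γ Γ' : Level V) (hle : Γ' ≤ Γ) (ω : (picardCMUniverse hHD hI h₁ h₃).CohC ((picardCMUniverse hHD hI h₁ h₃).pms L ι₁ V Γ) 1),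
      ω ∈ (thetaModelOf hHD hI h₁ h₃ (hb L ι₁) (embOf hHD hI h₁ h₃) (coverOf hHD hI h₁ h₃ hA) (wmOfInput W) (thetaOf _ (thetaClassInputOf _ X)) (d12Of μ) (d34Of μ)).Theta V c i Γ →
        (picardCMUniverse hHD hI h₁ h₃).pullC (coverOf hHD hI h₁ h₃ hA Γ Γ' (Level.Γ_mono hle)) 1 ω ∈ (thetaModelOf hHD hI h₁ h₃ (hb L ι₁) (embOf hHD hI h₁ h₃) (coverOf hHD hI h₁ h₃ hA) (wmOfInput W) (thetaOf _ (thetaClassInputOf _ X)) (d12Of μ) (d34Of μ)).Theta V c i Γ')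
    (transl : ∀ {L : CMField} {ι₁ : L →+* ℂ} (V : HermSpace3 L ι₁) (c : SeesawCtx L)
      (hc : (thetaModelOf hHD hI h₁ h₃ (hb L ι₁) (embOf hHD hI h₁ h₃) (coverOf hHD hI h₁ h₃ hA) (wmOfInput W) (thetaOf _ (thetaClassInputOf _ X)) (d12Of μ) (d34Of μ)).GoodCtx ι₁ c) (hK : scope c),
      ∀ γ ∈ (ballOf hHD hI h₁ h₃ V c (two_lt_finrank_of_goodCtx_ge hHD hI h₁ h₃ hc (hscope c hK))).Δ, ∀ (i : Fin 4) (Γ : Level V) (ω : (picardCMUniverse hHD hI h₁ h₃).CohC ((picardCMUniverse hHD hI h₁ h₃).pms L ι₁ V Γ) 1),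
      ω ∈ (thetaModelOf hHD hI h₁ h₃ (hb L ι₁) (embOf hHD hI h₁ h₃) (coverOf hHD hI h₁ h₃ hA) (wmOfInput W) (thetaOf _ (thetaClassInputOf _ X)) (d12Of μ) (d34Of μ)).Theta V c i Γ → ∃ (Γ' : Level V) (ω' : (picardCMUniverse hHD hI h₁ h₃).CohC ((picardCMUniverse hHD hI h₁ h₃).pms L ι₁ V Γ') 1),
        ω' ∈ (thetaModelOf hHD hI h₁ h₃ (hb L ι₁) (embOf hHD hI h₁ h₃) (coverOf hHD hI h₁ h₃ hA) (wmOfInput W) (thetaOf _ (thetaClassInputOf _ X)) (d12Of μ) (d34Of μ)).Theta V c i Γ' ∧ (ballOf hHD hI h₁ h₃ V c (two_lt_finrank_of_goodCtx_ge hHD hI h₁ h₃ hc (hscope c hK))).ev Γ' ω' =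
          fun x => (ballOf hHD hI h₁ h₃ V c (two_lt_finrank_of_goodCtx_ge hHD hI h₁ h₃ hc (hscope c hK))).J γ x *ᵥ (ballOf hHD hI h₁ h₃ V c (two_lt_finrank_of_goodCtx_ge hHD hI h₁ h₃ hc (hscope c hK))).ev Γ ω (γ • x))
    (A : ∀ {L : CMField} {ι₁ : L →+* ℂ} (V : HermSpace3 L ι₁) (c : SeesawCtx L),
      (thetaModelOf hHD hI h₁ h₃ (hb L ι₁) (embOf hHD hI h₁ h₃) (coverOf hHD hI h₁ h₃ hA) (wmOfInput W) (thetaOf _ (thetaClassInputOf _ X)) (d12Of μ) (d34Of μ)).GoodCtx ι₁ c → scope c →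
      (NumberField.InfinitePlace.mk ι₁).embedding = ι₁ →
        ∀ k : Fin 4, k = 0 ∨ k = 1 → ∀ N : ℕ, 0 < N → SupplySituationAt (X V c) k N)
    (gen12 : ∀ {L : CMField} {ι₁ : L →+* ℂ} (V : HermSpace3 L ι₁) (c : SeesawCtx L),
      (thetaModelOf hHD hI h₁ h₃ (hb L ι₁) (embOf hHD hI h₁ h₃) (coverOf hHD hI h₁ h₃ hA) (wmOfInput W) (thetaOf _ (thetaClassInputOf _ X)) (d12Of μ) (d34Of μ)).GoodCtx ι₁ c → scope c →
      (NumberField.InfinitePlace.mk ι₁).embedding = ι₁ →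
      Nonempty ((thetaModelOf hHD hI h₁ h₃ (hb L ι₁) (embOf hHD hI h₁ h₃) (coverOf hHD hI h₁ h₃ hA) (wmOfInput W) (thetaOf _ (thetaClassInputOf _ X)) (d12Of μ) (d34Of μ)).Gen12FunBridge V c))
    (real34 : ∀ {L : CMField} {ι₁ : L →+* ℂ} (V : HermSpace3 L ι₁) (c : SeesawCtx L),
      (thetaModelOf hHD hI h₁ h₃ (hb L ι₁) (embOf hHD hI h₁ h₃) (coverOf hHD hI h₁ h₃ hA) (wmOfInput W) (thetaOf _ (thetaClassInputOf _ X)) (d12Of μ) (d34Of μ)).GoodCtx ι₁ c → scope c →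
      (NumberField.InfinitePlace.mk ι₁).embedding = ι₁ →
      Nonempty ((thetaModelOf hHD hI h₁ h₃ (hb L ι₁) (embOf hHD hI h₁ h₃) (coverOf hHD hI h₁ h₃ hA) (wmOfInput W) (thetaOf _ (thetaClassInputOf _ X)) (d12Of μ) (d34Of μ)).Real34FunBridge V c))
    (hyp12 : ∀ {L : CMField} {ι₁ : L →+* ℂ} (V : HermSpace3 L ι₁) (c : SeesawCtx L),
      (thetaModelOf hHD hI h₁ h₃ (hb L ι₁) (embOf hHD hI h₁ h₃) (coverOf hHD hI h₁ h₃ hA) (wmOfInput W) (thetaOf _ (thetaClassInputOf _ X)) (d12Of μ) (d34Of μ)).GoodCtx ι₁ c → scope c →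
      (NumberField.InfinitePlace.mk ι₁).embedding = ι₁ →
      Nonempty (((coreOf _ (embOf hHD hI h₁ h₃) (coverOf hHD hI h₁ h₃ hA) (wmOfInput W) (thetaOf _ (thetaClassInputOf _ X))).toCore (hb L ι₁)).HypSmoothCore12
        (((coreOf _ (embOf hHD hI h₁ h₃) (coverOf hHD hI h₁ h₃ hA) (wmOfInput W) (thetaOf _ (thetaClassInputOf _ X))).toCore (hb L ι₁)).side12 (d12Of μ)) (((coreOf _ (embOf hHD hI h₁ h₃) (coverOf hHD hI h₁ h₃ hA) (wmOfInput W) (thetaOf _ (thetaClassInputOf _ X))).toCore (hb L ι₁)).side34 (d34Of μ))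
        ((((coreOf _ (embOf hHD hI h₁ h₃) (coverOf hHD hI h₁ h₃ hA) (wmOfInput W) (thetaOf _ (thetaClassInputOf _ X))).toCore (hb L ι₁)).analyticKM (((coreOf _ (embOf hHD hI h₁ h₃) (coverOf hHD hI h₁ h₃ hA) (wmOfInput W) (thetaOf _ (thetaClassInputOf _ X))).toCore (hb L ι₁)).side12 (d12Of μ))
          (((coreOf _ (embOf hHD hI h₁ h₃) (coverOf hHD hI h₁ h₃ hA) (wmOfInput W) (thetaOf _ (thetaClassInputOf _ X))).toCore (hb L ι₁)).side34 (d34Of μ))).toAnalytic) V c (ℓ := linOfInput W V c)))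
    (hyp34 : ∀ {L : CMField} {ι₁ : L →+* ℂ} (V : HermSpace3 L ι₁) (c : SeesawCtx L),
      (thetaModelOf hHD hI h₁ h₃ (hb L ι₁) (embOf hHD hI h₁ h₃) (coverOf hHD hI h₁ h₃ hA) (wmOfInput W) (thetaOf _ (thetaClassInputOf _ X)) (d12Of μ) (d34Of μ)).GoodCtx ι₁ c → scope c →
      (NumberField.InfinitePlace.mk ι₁).embedding = ι₁ →
      Nonempty (((coreOf _ (embOf hHD hI h₁ h₃) (coverOf hHD hI h₁ h₃ hA) (wmOfInput W) (thetaOf _ (thetaClassInputOf _ X))).toCore (hb L ι₁)).HypSmoothCore34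
        (((coreOf _ (embOf hHD hI h₁ h₃) (coverOf hHD hI h₁ h₃ hA) (wmOfInput W) (thetaOf _ (thetaClassInputOf _ X))).toCore (hb L ι₁)).side12 (d12Of μ)) (((coreOf _ (embOf hHD hI h₁ h₃) (coverOf hHD hI h₁ h₃ hA) (wmOfInput W) (thetaOf _ (thetaClassInputOf _ X))).toCore (hb L ι₁)).side34 (d34Of μ))
        ((((coreOf _ (embOf hHD hI h₁ h₃) (coverOf hHD hI h₁ h₃ hA) (wmOfInput W) (thetaOf _ (thetaClassInputOf _ X))).toCore (hb L ι₁)).analyticKM (((coreOf _ (embOf hHD hI h₁ h₃) (coverOf hHD hI h₁ h₃ hA) (wmOfInput W) (thetaOf _ (thetaClassInputOf _ X))).toCore (hb L ι₁)).side12 (d12Of μ))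
          (((coreOf _ (embOf hHD hI h₁ h₃) (coverOf hHD hI h₁ h₃ hA) (wmOfInput W) (thetaOf _ (thetaClassInputOf _ X))).toCore (hb L ι₁)).side34 (d34Of μ))).toAnalytic) V c (ℓ := linOfInput W V c))) :
    ∀ {L : CMField} {ι₁ : L →+* ℂ} (V : HermSpace3 L ι₁) (c : SeesawCtx L),
      (thetaModelOf hHD hI h₁ h₃ (hb L ι₁) (embOf hHD hI h₁ h₃) (coverOf hHD hI h₁ h₃ hA) (wmOfInput W) (thetaOf _ (thetaClassInputOf _ X)) (d12Of μ) (d34Of μ)).GoodCtx ι₁ c → scope c →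
      (NumberField.InfinitePlace.mk ι₁).embedding = ι₁ →
      Nonempty ((picardCMUniverse hHD hI h₁ h₃).ThetaRealisation₂ ι₁ V c.K c.Ψ c.σ) :=
  thetaRealisation₂_picardCMOG_S hHD hI h₁ h₃ scope hHR hb (embOf hHD hI h₁ h₃) (coverOf hHD hI h₁ h₃ hA) (wmOfInput W)
    (thetaOf _ (thetaClassInputOf _ X)) (d12Of μ) (d34Of μ)
    (fun {L} {ι₁} V c hc hK hcan => innerEmbAt_of_bettiSide hHD hI h₁ h₃ (hb L ι₁) (coverOf hHD hI h₁ h₃ hA) (wmOfInput W)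
      (thetaOf _ (thetaClassInputOf _ X)) (d12Of μ) (d34Of μ) V
      ((HermSpace3.isAnisotropic_iff_finrank_ne_two V).2 (two_lt_finrank_of_goodCtx_ge hHD hI h₁ h₃ hc (hscope c hK)).ne')
      (hBetti V))
    (thetaSub_of_factOG_S hHD hI h₁ h₃ scope hb hA W X μ h31 hLiu)
    (fun {L} {ι₁} V c hc hK hcan => (thetaModelOf hHD hI h₁ h₃ (hb L ι₁) (embOf hHD hI h₁ h₃) (coverOf hHD hI h₁ h₃ hA) (wmOfInput W) (thetaOf _ (thetaClassInputOf _ X)) (d12Of μ) (d34Of μ)).exists_cup_ne_zero_of_ballFacts V c (ballOf hHD hI h₁ h₃ V c (two_lt_finrank_of_goodCtx_ge hHD hI h₁ h₃ hc (hscope c hK)))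
      (ballFactsOf hHD hI h₁ h₃ V c _ (thetaModelOf hHD hI h₁ h₃ (hb L ι₁) (embOf hHD hI h₁ h₃) (coverOf hHD hI h₁ h₃ hA) (wmOfInput W) (thetaOf _ (thetaClassInputOf _ X)) (d12Of μ) (d34Of μ))
        (thetaSub_of_factOG_S hHD hI h₁ h₃ scope hb hA W X μ h31 hLiu V c hc hK hcan) (thetaSat V c)
        (fun Γ Γ' hle hV v hv => map_coverOf_unif hHD hI h₁ h₃ hA hle hV hv) (transl V c hc hK))
      (by
        let S₀ := classSupplyPackNOf (X V c) 0 (thetaModelOf hHD hI h₁ h₃ (hb L ι₁) (embOf hHD hI h₁ h₃) (coverOf hHD hI h₁ h₃ hA) (wmOfInput W) (thetaOf _ (thetaClassInputOf _ X)) (d12Of μ) (d34Of μ))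
          (fun _ _ hx => hx) (A V c hc hK hcan 0 (Or.inl rfl))
        let S₁ := classSupplyPackNOf (X V c) 1 (thetaModelOf hHD hI h₁ h₃ (hb L ι₁) (embOf hHD hI h₁ h₃) (coverOf hHD hI h₁ h₃ hA) (wmOfInput W) (thetaOf _ (thetaClassInputOf _ X)) (d12Of μ) (d34Of μ))
          (fun _ _ hx => hx) (A V c hc hK hcan 1 (Or.inr rfl))
        exact ⟨S₀.toPairSupplyData.toLineSupplyData.D.supply S₀.toPairSupplyData.toLineSupplyData.res,
          S₁.toPairSupplyData.toLineSupplyData.D.supply S₁.toPairSupplyData.toLineSupplyData.res⟩))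
    gen12 real34
    (fun {L} {ι₁} V c hc hK hcan =>
      ⟨fun Φ i hΦ => (hyp12 V c hc hK hcan).elim fun A => A.H_occ (ℓ := linOfInput W V c) Φ i hΦ,
        fun Φ i hΦ => (hyp34 V c hc hK hcan).elim fun A => A.H_occ (ℓ := linOfInput W V c) Φ i hΦ⟩)

end Model
end HodgeCM

end
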